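import Literature.MathematicalPhysics.KineticTheory.HierarchyContinuityEstimates
import HarnessLib

/-!
# Finite Duhamel iterations with remainder and the block expansion of a hierarchy (BGSR §4.3)
(Bodineau–Gallagher–Saint-Raymond, Invent. Math. 203 (2016) = arXiv:1305.3397v2, §4.3
"Collision trees of controlled size", (4.4)–(4.7), pp. 12–13; trunk T-KINETIC, topic
MathematicalPhysics/KineticTheory; layer N4a of the bottom-up plan recorded in
`TaggedSphereLinearBoltzmann` towards the named fact `Hilbert6.bgsr_theorem22` — the ALGEBRA of
the pruning argument, whose ESTIMATES (BGSR Prop. 4.3) come next.)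

BGSR §4.3 (p. 12): "we shall use a truncated series expansion instead of (3.6) and (3.8). Let us
fix a (small) parameter `h > 0` and a sequence `{n_k}_{k ≥ 1}` of integers to be tuned later. We
shall study the dynamics up to time `t := Kh` for some large integer `K`, by splitting the time
interval `[0, t]` into `K` intervals, and controlling the number of collisions on each interval.
… we start by using (3.3) with `s = 1`, during the time interval `[t - h, t]`: iterating
Duhamel's formula up to time `t - h` instead of time `0`, we have
`f_N^{(1)}(t) = ∑_{j_1=0}^{n_1-1} α^{j_1} Q_{1,1+j_1}(h) f_N^{(1+j_1)}(t - h) + R_{1,n_1}(t - h, t)`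
((4.4)), where `R_{1,n_1}` accounts for at least `n_1` collisions … Iterating this procedure `K`
times and truncating the trajectories with at least `n_k` collisions during the time interval
`[t - kh, t - (k-1)h]`, leads to the following expansion `f_N^{(1)}(t) = f_N^{(1,K)}(t) + R_N^K(t)`
((4.5)), where … `f_N^{(1,K)}(t) := ∑_{j_1=0}^{n_1-1} ⋯ ∑_{j_K=0}^{n_K-1} α^{J_K-1} Q_{1,J_1}(h)
Q_{J_1,J_2}(h) ⋯ Q_{J_{K-1},J_K}(h) f_N^{0(J_K)}` ((4.6)) and `R_N^K(t) := ∑_{k=1}^K ∑_{j_1} ⋯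
∑_{j_{k-1}} α^{J_{k-1}-1} Q_{1,J_1}(h) ⋯ Q_{J_{k-2},J_{k-1}}(h) R_{J_{k-1},n_k}(t - kh, t-(k-1)h)`";
and ((4.7)) the same expansion `g_α = g_α^{(1,K)} + R_α^{0,K}` for the Boltzmann hierarchy.

This file formalises this expansion ONCE for an abstract hierarchy (`HierarchyModel`: transports
by energy-preserving, jointly measurable maps of the phase spaces; collision operators that are
additive and homogeneous on measurable Gaussian-bounded densities, map measurably
parametrised densities to measurably parametrised ones, and satisfy the weighted single-step
estimate (4.11) — all of which the tree provides for `α C⁰_{s,s+1}` (`boltzmannModel`) and for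
`C_{s,s+1}` along energy-conserving measurable hard-sphere flows (`bbgkyModel`)), for an
abstract *two-time mild solution* `F` (`IsMildSolution`: `F(t' + h) = S(h) F(t') +
∫_0^h S(h - τ) C F(t' + τ) dτ` from every intermediate time `t'`, which is what "iterating
Duhamel's formula up to time `t - h` instead of time `0`" uses). With Bochner/interval integrals
every linearity step is an honest integrability statement; the bookkeeping of measurability and
Gaussian bounds through the iterated integrals (`IsNice`, `IsNiceT`, `duhamelStep_*`) is the
bulk of the file. The rate `α` is absorbed in the collision operator of the model
(`boltzmannModel G hG α` has `op = α C⁰`), so that `Q` below stands for the printed `α^n Q`.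

## Main definitions

* `Kinetic.IsGaussBdd g`, `Kinetic.IsNice g` — `|g| ≤ K e^{-b H}` for some `K`, `b > 0`
  (resp. and `g` measurable): the Lanford class in which all identities hold.
* `Kinetic.IsNiceT T u` — a time-dependent density jointly measurable in `(t, Z)` with a
  Gaussian bound uniform on `[0, T]`.
* `Kinetic.HierarchyModel d X` — the abstract hierarchy (fields `flow`, `op`, `opConst` and
  their axioms); `M.transport s t g = g ∘ M.flow s (-t)`; the Duhamel terms are the tree's
  `Kinetic.duhamelTerm M.transport M.op`.
* `Kinetic.HierarchyModel.IsMildSolution M T F` — two-time mild solutions on `[0, T]` in the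
  class `IsNiceT`.
* `Kinetic.HierarchyModel.iterRem M F t' n s h` — the remainder of the `n`-fold Duhamel iteration
  from time `t'` over a time span `h` (the `n`-fold iterated integral whose innermost slot is
  `F^{(s+n)}(t' + ·)`); `iterRem_spec`: `F^{(s)}(t'+h) = ∑_{j<n} Q_{s,s+j}(h) F(t') +
  iterRem n` — BGSR (4.4) with `R_{s,n}(t', t'+h) = iterRem n` (BGSR write the remainder as the
  tail `∑_{p ≥ n}` of the full Duhamel series; the finite-iteration remainder is the same
  function whenever that series converges, and needs no convergence).
* `Kinetic.HierarchyModel.blockOp M n h` (`G ↦ ∑_{j<n} Q_{·,·+j}(h) G`, one block) and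
  `Kinetic.HierarchyModel.blockComp M nseq h k = blockOp (nseq 0) h ∘ ⋯ ∘ blockOp (nseq (k-1)) h`
  (the first `k` blocks, outermost first); `blockComp_spec`: **the block expansion (4.5)**
  `F^{(s)}(t) = (blockComp K [F(t - Kh)])^{(s)} + ∑_{i<K} (blockComp i [Rem_i])^{(s)}`,
  `Rem_i^{(a)} = iterRem M F (t - (i+1)h) (nseq i) a h` — for `t = Kh` the first term is the
  printed `f^{(1,K)}` (the nested form of the sum (4.6) over `j_1, …, j_K`) and the second is
  `R^K` ((4.6), nested form).
* `Kinetic.boltzmannModel G hG α`, `Kinetic.bbgkyModel G hG ε N Φ hΦE hΦm` — the two instances,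
  with `duhamelTerm_boltzmannModel : Q = αⁿ Q⁰_{s,s+n}` (`Kinetic.boltzmannDuhamelTerm`) and
  `duhamelTerm_bbgkyModel : Q = Q_{s,s+n}` (`Kinetic.bbgkyDuhamelTerm`).

## References

* T. Bodineau, I. Gallagher, L. Saint-Raymond, *The Brownian motion as the limit of a
  deterministic system of hard-spheres*, Invent. Math. 203 (2016) 493–553 = arXiv:1305.3397v2,
  §4.3, (4.4)–(4.7), pp. 12–13.
* I. Gallagher, L. Saint-Raymond, B. Texier, *From Newton to Boltzmann* (2013), §4.3–4.4 (mild
  hierarchies), whose operators are the tree's `BBGKYMarginals`.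
-/

open MeasureTheory Metric Real Set Filter Topology Function
open scoped InnerProductSpace ENNReal Nat

namespace Literature.MathematicalPhysics.KineticTheory

noncomputable section

section Kinetic

variable {d : Type*} [Fintype d] {X : Type*} {s : ℕ}

/-! ## The Lanford class: measurable Gaussian-bounded densities -/

section Lanford

omit [Fintype d] in
/-- The kinetic energy of a configuration is nonnegative. [folklore] -/
theorem configEnergy_nonneg' [Fintype d] (Z : Literature.Analysis.FluidPDE.Config s d X) : 0 ≤ Literature.Analysis.FluidPDE.configEnergy Z := by
  unfold Literature.Analysis.FluidPDE.configEnergy; positivity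

/-- `g` is *Gaussian-bounded*: `|g(Z)| ≤ K e^{-b H(Z)}` for some `K` and some `b > 0`
(membership in some weighted space `X_{·,s,b}` of BGSR §4.2 / Lanford's class). [cite: BodineauGallagherSaintRaymondInvent2016, §4.2] -/
def IsGaussBdd (g : Literature.Analysis.FluidPDE.Config s d X → ℝ) : Prop :=
  ∃ K b : ℝ, 0 < b ∧ ∀ Z, |g Z| ≤ K * exp (-b * Literature.Analysis.FluidPDE.configEnergy Z)

namespace IsGaussBdd

/-- A Gaussian bound can be taken with a nonnegative constant. [folklore] -/
theorem exists_nonneg {g : Literature.Analysis.FluidPDE.Config s d X → ℝ} (hg : IsGaussBdd g) :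
    ∃ K b : ℝ, 0 ≤ K ∧ 0 < b ∧ ∀ Z, |g Z| ≤ K * exp (-b * Literature.Analysis.FluidPDE.configEnergy Z) := by
  obtain ⟨K, b, hb, h⟩ := hg
  refine ⟨max K 0, b, le_max_right _ _, hb, fun Z => (h Z).trans ?_⟩
  gcongr
  exact le_max_left _ _

/-- The zero function is Gaussian-bounded. [folklore] -/
theorem zero : IsGaussBdd (0 : Literature.Analysis.FluidPDE.Config s d X → ℝ) :=
  ⟨0, 1, one_pos, fun Z => by simp⟩

/-- Sums of Gaussian-bounded functions are Gaussian-bounded (rate `min b₁ b₂`). [folklore] -/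
theorem add {g₁ g₂ : Literature.Analysis.FluidPDE.Config s d X → ℝ} (h₁ : IsGaussBdd g₁) (h₂ : IsGaussBdd g₂) :
    IsGaussBdd (g₁ + g₂) := by
  obtain ⟨K₁, b₁, hK₁, hb₁, h₁⟩ := h₁.exists_nonneg
  obtain ⟨K₂, b₂, hK₂, hb₂, h₂⟩ := h₂.exists_nonneg
  refine ⟨K₁ + K₂, min b₁ b₂, lt_min hb₁ hb₂, fun Z => ?_⟩
  have hE := configEnergy_nonneg' Z
  have e₁ : exp (-b₁ * Literature.Analysis.FluidPDE.configEnergy Z) ≤ exp (-min b₁ b₂ * Literature.Analysis.FluidPDE.configEnergy Z) :=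
    exp_le_exp.2 (by nlinarith [min_le_left b₁ b₂])
  have e₂ : exp (-b₂ * Literature.Analysis.FluidPDE.configEnergy Z) ≤ exp (-min b₁ b₂ * Literature.Analysis.FluidPDE.configEnergy Z) :=
    exp_le_exp.2 (by nlinarith [min_le_right b₁ b₂])
  calc |(g₁ + g₂) Z| = |g₁ Z + g₂ Z| := rfl
    _ ≤ |g₁ Z| + |g₂ Z| := abs_add_le _ _
    _ ≤ K₁ * exp (-b₁ * Literature.Analysis.FluidPDE.configEnergy Z) + K₂ * exp (-b₂ * Literature.Analysis.FluidPDE.configEnergy Z) := add_le_add (h₁ Z) (h₂ Z)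
    _ ≤ K₁ * exp (-min b₁ b₂ * Literature.Analysis.FluidPDE.configEnergy Z) + K₂ * exp (-min b₁ b₂ * Literature.Analysis.FluidPDE.configEnergy Z) := by
        gcongr
    _ = (K₁ + K₂) * exp (-min b₁ b₂ * Literature.Analysis.FluidPDE.configEnergy Z) := by ring

/-- Scalar multiples of Gaussian-bounded functions are Gaussian-bounded. [folklore] -/
theorem smul {g : Literature.Analysis.FluidPDE.Config s d X → ℝ} (h : IsGaussBdd g) (c : ℝ) : IsGaussBdd (c • g) := by
  obtain ⟨K, b, hb, h⟩ := h
  refine ⟨|c| * K, b, hb, fun Z => ?_⟩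
  calc |(c • g) Z| = |c| * |g Z| := by simp [abs_mul]
    _ ≤ |c| * (K * exp (-b * Literature.Analysis.FluidPDE.configEnergy Z)) := mul_le_mul_of_nonneg_left (h Z) (abs_nonneg c)
    _ = |c| * K * exp (-b * Literature.Analysis.FluidPDE.configEnergy Z) := by ring

/-- Negatives of Gaussian-bounded functions are Gaussian-bounded. [folklore] -/
theorem neg {g : Literature.Analysis.FluidPDE.Config s d X → ℝ} (h : IsGaussBdd g) : IsGaussBdd (-g) := by
  simpa using h.smul (-1)

/-- Differences of Gaussian-bounded functions are Gaussian-bounded. [folklore] -/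
theorem sub {g₁ g₂ : Literature.Analysis.FluidPDE.Config s d X → ℝ} (h₁ : IsGaussBdd g₁) (h₂ : IsGaussBdd g₂) :
    IsGaussBdd (g₁ - g₂) := by
  simpa [sub_eq_add_neg] using h₁.add h₂.neg

/-- Finite sums of Gaussian-bounded functions are Gaussian-bounded. [folklore] -/
theorem sum {ι : Type*} (S : Finset ι) {g : ι → Literature.Analysis.FluidPDE.Config s d X → ℝ}
    (h : ∀ i ∈ S, IsGaussBdd (g i)) : IsGaussBdd (∑ i ∈ S, g i) := by
  classical
  induction S using Finset.induction_on with
  | empty => simpa using (zero : IsGaussBdd (0 : Literature.Analysis.FluidPDE.Config s d X → ℝ))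
  | insert a S ha ih =>
    rw [Finset.sum_insert ha]
    exact (h a (Finset.mem_insert_self a S)).add (ih fun i hi => h i (Finset.mem_insert_of_mem hi))

/-- A pointwise bound by a Gaussian-bounded function gives a Gaussian bound. [folklore] -/
theorem of_abs_le {g g' : Literature.Analysis.FluidPDE.Config s d X → ℝ} (h : IsGaussBdd g') (hle : ∀ Z, |g Z| ≤ |g' Z|) :
    IsGaussBdd g := by
  obtain ⟨K, b, hb, h⟩ := h
  exact ⟨K, b, hb, fun Z => (hle Z).trans (h Z)⟩

end IsGaussBdd

variable [MeasurableSpace X]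

/-- The *Lanford class*: measurable Gaussian-bounded densities — the class on which the
collision operators of the hierarchies are honestly additive (`HierarchyModel.op_add`). [folklore] -/
def IsNice (g : Literature.Analysis.FluidPDE.Config s d X → ℝ) : Prop :=
  Measurable g ∧ IsGaussBdd g

namespace IsNice

/-- The zero density is in the Lanford class. [folklore] -/
theorem zero : IsNice (0 : Literature.Analysis.FluidPDE.Config s d X → ℝ) := ⟨measurable_const, IsGaussBdd.zero⟩

/-- The Lanford class is closed under addition. [folklore] -/
theorem add {g₁ g₂ : Literature.Analysis.FluidPDE.Config s d X → ℝ} (h₁ : IsNice g₁) (h₂ : IsNice g₂) : IsNice (g₁ + g₂) :=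
  ⟨h₁.1.add h₂.1, h₁.2.add h₂.2⟩

/-- The Lanford class is closed under scalar multiplication. [folklore] -/
theorem smul {g : Literature.Analysis.FluidPDE.Config s d X → ℝ} (h : IsNice g) (c : ℝ) : IsNice (c • g) :=
  ⟨h.1.const_smul c, h.2.smul c⟩

/-- The Lanford class is closed under negation. [folklore] -/
theorem neg {g : Literature.Analysis.FluidPDE.Config s d X → ℝ} (h : IsNice g) : IsNice (-g) :=
  ⟨h.1.neg, h.2.neg⟩

/-- The Lanford class is closed under subtraction. [folklore] -/
theorem sub {g₁ g₂ : Literature.Analysis.FluidPDE.Config s d X → ℝ} (h₁ : IsNice g₁) (h₂ : IsNice g₂) : IsNice (g₁ - g₂) :=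
  ⟨h₁.1.sub h₂.1, h₁.2.sub h₂.2⟩

/-- The Lanford class is closed under finite sums. [folklore] -/
theorem sum {ι : Type*} (S : Finset ι) {g : ι → Literature.Analysis.FluidPDE.Config s d X → ℝ} (h : ∀ i ∈ S, IsNice (g i)) :
    IsNice (∑ i ∈ S, g i) := by
  refine ⟨?_, IsGaussBdd.sum S fun i hi => (h i hi).2⟩
  have hm := Finset.measurable_sum S fun i hi => (h i hi).1
  have heq : (∑ i ∈ S, g i) = fun a => ∑ i ∈ S, g i a := by
    funext a
    simp [Finset.sum_apply]
  rw [heq]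
  exact hm

end IsNice

/-- A time-dependent density in the Lanford class, locally uniformly on `[0, T]`: jointly
measurable in `(t, Z)` with one Gaussian bound for all `t ∈ [0, T]` (the regularity of the
hypotheses `hmeas`, `hbound` of `Kinetic.IsMildBBGKYSolutionOn.eq_sum_bbgkyDuhamelTerm`). [folklore] -/
structure IsNiceT (T : ℝ) (u : ℝ → Literature.Analysis.FluidPDE.Config s d X → ℝ) : Prop where
  measurable : Measurable fun p : ℝ × Literature.Analysis.FluidPDE.Config s d X => u p.1 p.2
  bound : ∃ K b : ℝ, 0 < b ∧ ∀ t ∈ Icc 0 T, ∀ Z, |u t Z| ≤ K * exp (-b * Literature.Analysis.FluidPDE.configEnergy Z)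

namespace IsNiceT

variable {T : ℝ}

/-- Each time slice of a nice time-dependent density is nice. [folklore] -/
theorem isNice {u : ℝ → Literature.Analysis.FluidPDE.Config s d X → ℝ} (hu : IsNiceT T u) {t : ℝ} (ht : t ∈ Icc 0 T) :
    IsNice (u t) := by
  obtain ⟨K, b, hb, h⟩ := hu.bound
  exact ⟨hu.measurable.comp (measurable_const.prodMk measurable_id), K, b, hb, h t ht⟩

/-- The bound of a nice time-dependent density can be taken with `K ≥ 0`. [folklore] -/
theorem exists_nonneg {u : ℝ → Literature.Analysis.FluidPDE.Config s d X → ℝ} (hu : IsNiceT T u) :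
    ∃ K b : ℝ, 0 ≤ K ∧ 0 < b ∧ ∀ t ∈ Icc 0 T, ∀ Z, |u t Z| ≤ K * exp (-b * Literature.Analysis.FluidPDE.configEnergy Z) := by
  obtain ⟨K, b, hb, h⟩ := hu.bound
  refine ⟨max K 0, b, le_max_right _ _, hb, fun t ht Z => (h t ht Z).trans ?_⟩
  gcongr
  exact le_max_left _ _

/-- `IsNiceT` is closed under addition (constants uniform in `t`). [folklore] -/
theorem add {u₁ u₂ : ℝ → Literature.Analysis.FluidPDE.Config s d X → ℝ} (h₁ : IsNiceT T u₁) (h₂ : IsNiceT T u₂) :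
    IsNiceT T (fun t => u₁ t + u₂ t) := by
  refine ⟨h₁.measurable.add h₂.measurable, ?_⟩
  obtain ⟨K₁, b₁, hK₁, hb₁, h₁'⟩ := h₁.exists_nonneg
  obtain ⟨K₂, b₂, hK₂, hb₂, h₂'⟩ := h₂.exists_nonneg
  refine ⟨K₁ + K₂, min b₁ b₂, lt_min hb₁ hb₂, fun t ht Z => ?_⟩
  obtain ⟨K, b, hb, h⟩ := (IsGaussBdd.add ⟨K₁, b₁, hb₁, fun Z => h₁' t ht Z⟩
    ⟨K₂, b₂, hb₂, fun Z => h₂' t ht Z⟩ : IsGaussBdd (u₁ t + u₂ t))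
  -- redo the explicit computation to keep the constants uniform in `t`
  have hE := configEnergy_nonneg' Z
  have e₁ : exp (-b₁ * Literature.Analysis.FluidPDE.configEnergy Z) ≤ exp (-min b₁ b₂ * Literature.Analysis.FluidPDE.configEnergy Z) :=
    exp_le_exp.2 (by nlinarith [min_le_left b₁ b₂])
  have e₂ : exp (-b₂ * Literature.Analysis.FluidPDE.configEnergy Z) ≤ exp (-min b₁ b₂ * Literature.Analysis.FluidPDE.configEnergy Z) :=
    exp_le_exp.2 (by nlinarith [min_le_right b₁ b₂])
  calc |u₁ t Z + u₂ t Z| ≤ |u₁ t Z| + |u₂ t Z| := abs_add_le _ _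
    _ ≤ K₁ * exp (-b₁ * Literature.Analysis.FluidPDE.configEnergy Z) + K₂ * exp (-b₂ * Literature.Analysis.FluidPDE.configEnergy Z) :=
        add_le_add (h₁' t ht Z) (h₂' t ht Z)
    _ ≤ K₁ * exp (-min b₁ b₂ * Literature.Analysis.FluidPDE.configEnergy Z) + K₂ * exp (-min b₁ b₂ * Literature.Analysis.FluidPDE.configEnergy Z) := by
        gcongr
    _ = (K₁ + K₂) * exp (-min b₁ b₂ * Literature.Analysis.FluidPDE.configEnergy Z) := by ring

/-- `IsNiceT` is closed under scalar multiplication. [folklore] -/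
theorem smul {u : ℝ → Literature.Analysis.FluidPDE.Config s d X → ℝ} (h : IsNiceT T u) (c : ℝ) :
    IsNiceT T (fun t => c • u t) := by
  refine ⟨h.measurable.const_smul c, ?_⟩
  obtain ⟨K, b, hb, h'⟩ := h.bound
  refine ⟨|c| * K, b, hb, fun t ht Z => ?_⟩
  calc |(c • u t) Z| = |c| * |u t Z| := by simp [abs_mul]
    _ ≤ |c| * (K * exp (-b * Literature.Analysis.FluidPDE.configEnergy Z)) := mul_le_mul_of_nonneg_left (h' t ht Z) (abs_nonneg c)
    _ = |c| * K * exp (-b * Literature.Analysis.FluidPDE.configEnergy Z) := by ring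

/-- `IsNiceT` is closed under negation. [folklore] -/
theorem neg {u : ℝ → Literature.Analysis.FluidPDE.Config s d X → ℝ} (h : IsNiceT T u) : IsNiceT T (fun t => -u t) := by
  simpa using h.smul (-1)

/-- `IsNiceT` is closed under subtraction. [folklore] -/
theorem sub {u₁ u₂ : ℝ → Literature.Analysis.FluidPDE.Config s d X → ℝ} (h₁ : IsNiceT T u₁) (h₂ : IsNiceT T u₂) :
    IsNiceT T (fun t => u₁ t - u₂ t) := by
  simpa [sub_eq_add_neg] using h₁.add h₂.neg

/-- `IsNiceT` is closed under finite sums. [folklore] -/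
theorem sum {ι : Type*} (S : Finset ι) {u : ι → ℝ → Literature.Analysis.FluidPDE.Config s d X → ℝ}
    (h : ∀ i ∈ S, IsNiceT T (u i)) : IsNiceT T (fun t => ∑ i ∈ S, u i t) := by
  classical
  induction S using Finset.induction_on with
  | empty =>
    refine ⟨?_, 0, 1, one_pos, fun t _ Z => ?_⟩
    · simp only [Finset.sum_empty]
      exact measurable_const
    · simp only [Finset.sum_empty, Pi.zero_apply, abs_zero, zero_mul, le_refl]
  | insert a S ha ih =>
    have h' := (h a (Finset.mem_insert_self a S)).add (ih fun i hi => h i (Finset.mem_insert_of_mem hi))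
    refine ⟨?_, ?_⟩
    · convert h'.measurable using 1
      funext p
      simp [Finset.sum_insert ha]
    · obtain ⟨K, b, hb, hK⟩ := h'.bound
      exact ⟨K, b, hb, fun t ht Z => by simpa [Finset.sum_insert ha] using hK t ht Z⟩

/-- Restriction to a shorter time interval. [folklore] -/
theorem mono {u : ℝ → Literature.Analysis.FluidPDE.Config s d X → ℝ} (h : IsNiceT T u) {T' : ℝ} (hT' : T' ≤ T) :
    IsNiceT T' u := by
  obtain ⟨K, b, hb, h'⟩ := h.bound
  exact ⟨h.measurable, K, b, hb, fun t ht Z => h' t ⟨ht.1, ht.2.trans hT'⟩ Z⟩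

/-- Time shift: `h ↦ u (t' + h)` is nice on `[0, T - t']` for `t' ≥ 0`. [folklore] -/
theorem shift {u : ℝ → Literature.Analysis.FluidPDE.Config s d X → ℝ} (h : IsNiceT T u) {t' : ℝ} (ht' : 0 ≤ t') :
    IsNiceT (T - t') (fun τ => u (t' + τ)) := by
  obtain ⟨K, b, hb, h'⟩ := h.bound
  refine ⟨h.measurable.comp ((measurable_fst.const_add t').prodMk measurable_snd), K, b, hb,
    fun τ hτ Z => h' (t' + τ) ⟨by linarith [hτ.1], by linarith [hτ.2]⟩ Z⟩

/-- A time-independent nice density is nice as a (constant) time-dependent one. [folklore] -/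
theorem const {g : Literature.Analysis.FluidPDE.Config s d X → ℝ} (hg : IsNice g) (T : ℝ) : IsNiceT T (fun _ => g) := by
  obtain ⟨K, b, hb, h⟩ := hg.2
  exact ⟨hg.1.comp measurable_snd, K, b, hb, fun _ _ Z => h Z⟩

end IsNiceT

end Lanford

/-! ## Abstract hierarchies -/

section Model

variable [MeasurableSpace X]

variable (d X) in
/-- An abstract hierarchy of BBGKY/Boltzmann type on the phase spaces `Config s d X`: transport
along maps `flow s t` preserving the kinetic energy and jointly measurable in `(t, Z)`, and
collision operators `op s : (Config (s+1) → ℝ) → (Config s → ℝ)` that are additive on the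
Lanford class, homogeneous, map measurably parametrised densities to measurably parametrised
densities, and satisfy the single-step weighted estimate (4.11) of BGSR with constant `opConst`
(`Kinetic.abs_boltzmannHOp_le_weighted`, `Kinetic.abs_bbgkyOp_le_weighted`). Instances:
`boltzmannModel` (free flight, `α C⁰_{s,s+1}`), `bbgkyModel` (hard-sphere flows, `C_{s,s+1}`).
[cite: BodineauGallagherSaintRaymondInvent2016, §3 (3.3)-(3.8), §4.2 (4.11)] -/
structure HierarchyModel where
  /-- The `s`-particle flows `Φ^s_t`. -/
  flow : (s : ℕ) → ℝ → Literature.Analysis.FluidPDE.Config s d X → Literature.Analysis.FluidPDE.Config s d X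
  /-- The collision operators `C_{s,s+1}` (rate included). -/
  op : (s : ℕ) → (Literature.Analysis.FluidPDE.Config (s + 1) d X → ℝ) → Literature.Analysis.FluidPDE.Config s d X → ℝ
  /-- The constant of the single-step weighted estimate (4.11). -/
  opConst : ℝ
  /-- The flows preserve the kinetic energy. -/
  configEnergy_flow : ∀ (s : ℕ) (t : ℝ) (Z : Literature.Analysis.FluidPDE.Config s d X), Literature.Analysis.FluidPDE.configEnergy (flow s t Z) = Literature.Analysis.FluidPDE.configEnergy Z
  /-- The flows are jointly measurable in time and datum. -/
  measurable_flow : ∀ s : ℕ, Measurable fun p : ℝ × Literature.Analysis.FluidPDE.Config s d X => flow s p.1 p.2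
  /-- The collision operators preserve measurability in a real parameter. -/
  measurable_op : ∀ (s : ℕ) {u : ℝ × Literature.Analysis.FluidPDE.Config (s + 1) d X → ℝ}, Measurable u →
    Measurable fun p : ℝ × Literature.Analysis.FluidPDE.Config s d X => op s (fun Z => u (p.1, Z)) p.2
  /-- The collision operators are additive on the Lanford class. -/
  op_add : ∀ (s : ℕ) {g₁ g₂ : Literature.Analysis.FluidPDE.Config (s + 1) d X → ℝ}, IsNice g₁ → IsNice g₂ →
    op s (g₁ + g₂) = op s g₁ + op s g₂
  /-- The collision operators are homogeneous. -/
  op_smul : ∀ (s : ℕ) (c : ℝ) (g : Literature.Analysis.FluidPDE.Config (s + 1) d X → ℝ), op s (c • g) = c • op s g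
  /-- The constant of (4.11) is nonnegative. -/
  opConst_nonneg : 0 ≤ opConst
  /-- The single-step weighted estimate (4.11). -/
  op_weighted : ∀ (k : ℕ) (g : Literature.Analysis.FluidPDE.Config (k + 1) d X → ℝ) (K b : ℝ), 0 < b → 0 ≤ K →
    (∀ Z, |g Z| ≤ K * exp (-b * Literature.Analysis.FluidPDE.configEnergy Z)) →
    ∀ Z : Literature.Analysis.FluidPDE.Config k d X, |op k g Z| ≤
      opConst * (sqrt b ^ Fintype.card d)⁻¹ * (k * (sqrt b)⁻¹ + ∑ i, ‖(Z i).2‖) *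
        (K * exp (-b * Literature.Analysis.FluidPDE.configEnergy Z))

namespace HierarchyModel

variable (M : HierarchyModel d X)

/-- The transport `(S_s(t) g)(Z_s) = g(Φ^s_{-t} Z_s)` of the model (GST (4.3.7)). [cite: GST2013, (4.3.7)] -/
def transport (s : ℕ) (t : ℝ) (g : Literature.Analysis.FluidPDE.Config s d X → ℝ) : Literature.Analysis.FluidPDE.Config s d X → ℝ :=
  fun Z => g (M.flow s (-t) Z)

/-- Unfolding lemma for the transport of a model. [folklore] -/
@[simp]
theorem transport_apply (s : ℕ) (t : ℝ) (g : Literature.Analysis.FluidPDE.Config s d X → ℝ) (Z : Literature.Analysis.FluidPDE.Config s d X) :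
    M.transport s t g Z = g (M.flow s (-t) Z) := rfl

/-- The transports are compositions with energy-preserving maps (the hypothesis `htr` of
`Kinetic.abs_duhamelChain_le_weighted`). [folklore] -/
theorem transport_energy (s : ℕ) (t : ℝ) (g : Literature.Analysis.FluidPDE.Config s d X → ℝ) (Z : Literature.Analysis.FluidPDE.Config s d X) :
    ∃ Z' : Literature.Analysis.FluidPDE.Config s d X, Literature.Analysis.FluidPDE.configEnergy Z' = Literature.Analysis.FluidPDE.configEnergy Z ∧ M.transport s t g Z = g Z' :=
  ⟨M.flow s (-t) Z, M.configEnergy_flow s (-t) Z, rfl⟩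

/-- The collision operators kill the zero density. [folklore] -/
theorem op_zero (s : ℕ) : M.op s 0 = 0 := by
  have h := M.op_smul s 0 0
  simpa using h

/-- The collision operators commute with negation. [folklore] -/
theorem op_neg (s : ℕ) (g : Literature.Analysis.FluidPDE.Config (s + 1) d X → ℝ) : M.op s (-g) = -M.op s g := by
  have h := M.op_smul s (-1) g
  simpa using h

/-- The collision operators are subtractive on the Lanford class. [folklore] -/
theorem op_sub (s : ℕ) {g₁ g₂ : Literature.Analysis.FluidPDE.Config (s + 1) d X → ℝ} (h₁ : IsNice g₁) (h₂ : IsNice g₂) :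
    M.op s (g₁ - g₂) = M.op s g₁ - M.op s g₂ := by
  rw [sub_eq_add_neg, M.op_add s h₁ h₂.neg, M.op_neg, ← sub_eq_add_neg]

/-- The collision operators are finitely additive on the Lanford class. [folklore] -/
theorem op_finset_sum (s : ℕ) {ι : Type*} (S : Finset ι) {g : ι → Literature.Analysis.FluidPDE.Config (s + 1) d X → ℝ}
    (h : ∀ i ∈ S, IsNice (g i)) : M.op s (∑ i ∈ S, g i) = ∑ i ∈ S, M.op s (g i) := by
  classical
  induction S using Finset.induction_on with
  | empty => simp [M.op_zero]
  | insert a S ha ih =>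
    rw [Finset.sum_insert ha, Finset.sum_insert ha,
      M.op_add s (h a (Finset.mem_insert_self a S))
        (IsNice.sum S fun i hi => h i (Finset.mem_insert_of_mem hi)),
      ih fun i hi => h i (Finset.mem_insert_of_mem hi)]

/-- The crude Gaussian bound of the collision operator derived from (4.11): the velocity
moment is absorbed by half of the weight (`Kinetic.sum_norm_mul_exp_neg_mul_configEnergy_le`).
[folklore] -/
theorem abs_op_le (k : ℕ) {g : Literature.Analysis.FluidPDE.Config (k + 1) d X → ℝ} {K b : ℝ} (hb : 0 < b) (hK : 0 ≤ K)
    (hg : ∀ Z, |g Z| ≤ K * exp (-b * Literature.Analysis.FluidPDE.configEnergy Z)) (Z : Literature.Analysis.FluidPDE.Config k d X) :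
    |M.op k g Z| ≤ M.opConst * (sqrt b ^ Fintype.card d)⁻¹ * (k * (sqrt b)⁻¹ + sqrt (k / (b / 2))) *
      K * exp (-(b / 2) * Literature.Analysis.FluidPDE.configEnergy Z) := by
  have h := M.op_weighted k g K b hb hK hg Z
  have hmom := sum_norm_mul_exp_neg_mul_configEnergy_le Z (half_pos hb)
  have hC := M.opConst_nonneg
  have hexp : exp (-b * Literature.Analysis.FluidPDE.configEnergy Z) = exp (-(b / 2) * Literature.Analysis.FluidPDE.configEnergy Z) * exp (-(b / 2) * Literature.Analysis.FluidPDE.configEnergy Z) := by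
    rw [← exp_add]; congr 1; ring
  have hexp1 : exp (-(b / 2) * Literature.Analysis.FluidPDE.configEnergy Z) ≤ 1 :=
    exp_le_one_iff.2 (by nlinarith [configEnergy_nonneg' Z])
  refine h.trans ?_
  calc M.opConst * (sqrt b ^ Fintype.card d)⁻¹ * (k * (sqrt b)⁻¹ + ∑ i, ‖(Z i).2‖) *
        (K * exp (-b * Literature.Analysis.FluidPDE.configEnergy Z))
      = M.opConst * (sqrt b ^ Fintype.card d)⁻¹ * K *
          ((k * (sqrt b)⁻¹) * exp (-(b / 2) * Literature.Analysis.FluidPDE.configEnergy Z) +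
            (∑ i, ‖(Z i).2‖) * exp (-(b / 2) * Literature.Analysis.FluidPDE.configEnergy Z)) *
          exp (-(b / 2) * Literature.Analysis.FluidPDE.configEnergy Z) := by rw [hexp]; ring
    _ ≤ M.opConst * (sqrt b ^ Fintype.card d)⁻¹ * K *
          ((k * (sqrt b)⁻¹) * 1 + sqrt (k / (b / 2))) * exp (-(b / 2) * Literature.Analysis.FluidPDE.configEnergy Z) := by
        gcongr
    _ = _ := by ring

/-- The collision operators map the Lanford class to Gaussian-bounded functions. [folklore] -/
theorem isGaussBdd_op (k : ℕ) {g : Literature.Analysis.FluidPDE.Config (k + 1) d X → ℝ} (hg : IsGaussBdd g) :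
    IsGaussBdd (M.op k g) := by
  obtain ⟨K, b, hK, hb, h⟩ := hg.exists_nonneg
  exact ⟨M.opConst * (sqrt b ^ Fintype.card d)⁻¹ * (k * (sqrt b)⁻¹ + sqrt (k / (b / 2))) * K, b / 2,
    half_pos hb, fun Z => M.abs_op_le k hb hK h Z⟩

end HierarchyModel

end Model

/-! ## One Duhamel step: `w(t) = ∫_0^t S(t-τ) C u(τ) dτ` -/

section Step

variable [MeasurableSpace X] (M : HierarchyModel d X) {T : ℝ}

/-- The integrand of one Duhamel step, `(t, Z, τ) ↦ (C u(τ))(Φ_{-(t-τ)} Z)`, is jointly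
measurable. [folklore] -/
theorem measurable_duhamelIntegrand {u : ℝ → Literature.Analysis.FluidPDE.Config (s + 1) d X → ℝ}
    (hu : Measurable fun p : ℝ × Literature.Analysis.FluidPDE.Config (s + 1) d X => u p.1 p.2) :
    Measurable fun q : (ℝ × Literature.Analysis.FluidPDE.Config s d X) × ℝ =>
      M.transport s (q.1.1 - q.2) (M.op s (u q.2)) q.1.2 := by
  have hW : Measurable fun q : ℝ × Literature.Analysis.FluidPDE.Config s d X => M.op s (u q.1) q.2 := M.measurable_op s hu
  have h1 : Measurable fun q : (ℝ × Literature.Analysis.FluidPDE.Config s d X) × ℝ => (-(q.1.1 - q.2), q.1.2) :=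
    (measurable_fst.fst.sub measurable_snd).neg.prodMk measurable_fst.snd
  have h2 : Measurable fun q : (ℝ × Literature.Analysis.FluidPDE.Config s d X) × ℝ => (q.2, M.flow s (-(q.1.1 - q.2)) q.1.2) :=
    measurable_snd.prodMk ((M.measurable_flow s).comp h1)
  exact hW.comp h2

/-- **One Duhamel step preserves the class `IsNiceT`**: if `u` is nice on `[0, T]` (`T ≥ 0`)
then so is `w(t) = ∫_0^t S(t-τ) C u(τ) dτ` (joint measurability by Fubini measurability of
parametric interval integrals, Gaussian bound `A K T e^{-b H/2}` by `abs_op_le`). [folklore] -/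
theorem isNiceT_duhamelStep {u : ℝ → Literature.Analysis.FluidPDE.Config (s + 1) d X → ℝ} (hu : IsNiceT T u) :
    IsNiceT T (fun t Z => ∫ τ in (0 : ℝ)..t, M.transport s (t - τ) (M.op s (u τ)) Z) := by
  refine ⟨Literature.Analysis.FluidPDE.measurable_intervalIntegral_param (measurable_duhamelIntegrand M hu.measurable)
    measurable_fst, ?_⟩
  obtain ⟨K, b, hK, hb, h⟩ := hu.exists_nonneg
  set A := M.opConst * (sqrt b ^ Fintype.card d)⁻¹ * (s * (sqrt b)⁻¹ + sqrt (s / (b / 2))) with hA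
  have hA0 : 0 ≤ A := by have := M.opConst_nonneg; positivity
  refine ⟨A * K * T, b / 2, half_pos hb, fun t ht Z => ?_⟩
  have hle : ∀ τ ∈ uIoc (0 : ℝ) t,
      ‖M.transport s (t - τ) (M.op s (u τ)) Z‖ ≤ A * K * exp (-(b / 2) * Literature.Analysis.FluidPDE.configEnergy Z) := by
    intro τ hτ
    rw [uIoc_of_le ht.1] at hτ
    rw [Real.norm_eq_abs, M.transport_apply, ← M.configEnergy_flow s (-(t - τ)) Z]
    have := M.abs_op_le s hb hK (h τ ⟨hτ.1.le, hτ.2.trans ht.2⟩) (M.flow s (-(t - τ)) Z)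
    simpa only [hA, mul_assoc] using this
  calc |∫ τ in (0 : ℝ)..t, M.transport s (t - τ) (M.op s (u τ)) Z|
      ≤ A * K * exp (-(b / 2) * Literature.Analysis.FluidPDE.configEnergy Z) * |t - 0| :=
        intervalIntegral.norm_integral_le_of_norm_le_const hle
    _ ≤ A * K * exp (-(b / 2) * Literature.Analysis.FluidPDE.configEnergy Z) * T := by
        rw [sub_zero, abs_of_nonneg ht.1]; gcongr; exact ht.2
    _ = A * K * T * exp (-(b / 2) * Literature.Analysis.FluidPDE.configEnergy Z) := by ring

/-- The integrand of one Duhamel step is interval integrable on `[0, t] ⊆ [0, T]`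
(measurable and bounded). [folklore] -/
theorem intervalIntegrable_duhamelStep {u : ℝ → Literature.Analysis.FluidPDE.Config (s + 1) d X → ℝ} (hu : IsNiceT T u)
    {t : ℝ} (ht : t ∈ Icc 0 T) (Z : Literature.Analysis.FluidPDE.Config s d X) :
    IntervalIntegrable (fun τ => M.transport s (t - τ) (M.op s (u τ)) Z) volume 0 t := by
  obtain ⟨K, b, hK, hb, h⟩ := hu.exists_nonneg
  set A := M.opConst * (sqrt b ^ Fintype.card d)⁻¹ * (s * (sqrt b)⁻¹ + sqrt (s / (b / 2))) with hA
  have h2 : Measurable fun τ : ℝ => ((t, Z), τ) := measurable_const.prodMk measurable_id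
  have hmeas : Measurable fun τ => M.transport s (t - τ) (M.op s (u τ)) Z :=
    (measurable_duhamelIntegrand M hu.measurable).comp h2
  refine (intervalIntegrable_const (c := A * K * exp (-(b / 2) * Literature.Analysis.FluidPDE.configEnergy Z))).mono_fun'
    hmeas.aestronglyMeasurable ?_
  refine (ae_restrict_mem measurableSet_uIoc).mono fun τ hτ => ?_
  rw [uIoc_of_le ht.1] at hτ
  dsimp only
  rw [Real.norm_eq_abs, M.transport_apply, ← M.configEnergy_flow s (-(t - τ)) Z]
  have := M.abs_op_le s hb hK (h τ ⟨hτ.1.le, hτ.2.trans ht.2⟩) (M.flow s (-(t - τ)) Z)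
  simpa only [hA, mul_assoc] using this

/-- **Additivity of one Duhamel step** on nice time-dependent densities, for `t ∈ [0, T]`.
[folklore] -/
theorem duhamelStep_add {u₁ u₂ : ℝ → Literature.Analysis.FluidPDE.Config (s + 1) d X → ℝ} (h₁ : IsNiceT T u₁)
    (h₂ : IsNiceT T u₂) {t : ℝ} (ht : t ∈ Icc 0 T) (Z : Literature.Analysis.FluidPDE.Config s d X) :
    ∫ τ in (0 : ℝ)..t, M.transport s (t - τ) (M.op s (u₁ τ + u₂ τ)) Z =
      (∫ τ in (0 : ℝ)..t, M.transport s (t - τ) (M.op s (u₁ τ)) Z) +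
        ∫ τ in (0 : ℝ)..t, M.transport s (t - τ) (M.op s (u₂ τ)) Z := by
  rw [← intervalIntegral.integral_add (intervalIntegrable_duhamelStep M h₁ ht Z)
    (intervalIntegrable_duhamelStep M h₂ ht Z)]
  refine intervalIntegral.integral_congr fun τ hτ => ?_
  rw [uIcc_of_le ht.1] at hτ
  have hτT : τ ∈ Icc 0 T := ⟨hτ.1, hτ.2.trans ht.2⟩
  simp only [M.transport_apply]
  rw [M.op_add s (h₁.isNice hτT) (h₂.isNice hτT), Pi.add_apply]

/-- Homogeneity of one Duhamel step (no hypothesis). [folklore] -/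
theorem duhamelStep_smul (c : ℝ) (u : ℝ → Literature.Analysis.FluidPDE.Config (s + 1) d X → ℝ) (t : ℝ) (Z : Literature.Analysis.FluidPDE.Config s d X) :
    ∫ τ in (0 : ℝ)..t, M.transport s (t - τ) (M.op s (c • u τ)) Z =
      c * ∫ τ in (0 : ℝ)..t, M.transport s (t - τ) (M.op s (u τ)) Z := by
  rw [← intervalIntegral.integral_const_mul]
  refine intervalIntegral.integral_congr fun τ _ => ?_
  simp only [M.transport_apply, M.op_smul, Pi.smul_apply, smul_eq_mul]

/-- Finite additivity of one Duhamel step on nice time-dependent densities. [folklore] -/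
theorem duhamelStep_finset_sum {ι : Type*} (S : Finset ι) {u : ι → ℝ → Literature.Analysis.FluidPDE.Config (s + 1) d X → ℝ}
    (h : ∀ i ∈ S, IsNiceT T (u i)) {t : ℝ} (ht : t ∈ Icc 0 T) (Z : Literature.Analysis.FluidPDE.Config s d X) :
    ∫ τ in (0 : ℝ)..t, M.transport s (t - τ) (M.op s (∑ i ∈ S, u i τ)) Z =
      ∑ i ∈ S, ∫ τ in (0 : ℝ)..t, M.transport s (t - τ) (M.op s (u i τ)) Z := by
  classical
  induction S using Finset.induction_on with
  | empty => simp [M.op_zero]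
  | insert a S ha ih =>
    have hS : IsNiceT T (fun τ => ∑ i ∈ S, u i τ) :=
      IsNiceT.sum S fun i hi => h i (Finset.mem_insert_of_mem hi)
    simp only [Finset.sum_insert ha]
    rw [duhamelStep_add M (h a (Finset.mem_insert_self a S)) hS ht Z,
      ih fun i hi => h i (Finset.mem_insert_of_mem hi)]

end Step

/-! ## The Duhamel terms `Q_{s,s+n}(t) G` on nice families -/

section Terms

variable [MeasurableSpace X] (M : HierarchyModel d X) {T : ℝ}

/-- **Duhamel terms of nice families are nice in time**, on every `[0, T]`: by induction on
the order, `isNiceT_duhamelStep`. [folklore] -/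
theorem isNiceT_duhamelTerm {G : Literature.Analysis.FluidPDE.GCState d X} (hG : ∀ k, IsNice (G k)) (n : ℕ) :
    ∀ s : ℕ, IsNiceT T (fun t => Literature.Analysis.FluidPDE.duhamelTerm M.transport M.op n s t G) := by
  induction n with
  | zero =>
    intro s
    obtain ⟨K, b, hb, h⟩ := (hG s).2
    refine ⟨?_, K, b, hb, fun t _ Z => ?_⟩
    · simp only [Literature.Analysis.FluidPDE.duhamelTerm_zero, HierarchyModel.transport]
      exact (hG s).1.comp ((M.measurable_flow s).comp (measurable_fst.neg.prodMk measurable_snd))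
    · rw [Literature.Analysis.FluidPDE.duhamelTerm_zero, M.transport_apply, ← M.configEnergy_flow s (-t) Z]
      exact h _
  | succ n ih =>
    intro s
    exact isNiceT_duhamelStep M (ih (s + 1))

/-- Each Duhamel term of a nice family, at a time `t ≥ 0`, is a nice function. [folklore] -/
theorem isNice_duhamelTerm {G : Literature.Analysis.FluidPDE.GCState d X} (hG : ∀ k, IsNice (G k)) (n s : ℕ) {t : ℝ}
    (ht : 0 ≤ t) : IsNice (Literature.Analysis.FluidPDE.duhamelTerm M.transport M.op n s t G) :=
  (isNiceT_duhamelTerm M hG n s).isNice ⟨ht, le_rfl⟩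

/-- **Homogeneity of the Duhamel terms** in the family (no hypothesis): `Q(c G) = c Q(G)`.
[folklore] -/
theorem duhamelTerm_smul (c : ℝ) (G : Literature.Analysis.FluidPDE.GCState d X) (n : ℕ) :
    ∀ (s : ℕ) (t : ℝ) (Z : Literature.Analysis.FluidPDE.Config s d X),
      Literature.Analysis.FluidPDE.duhamelTerm M.transport M.op n s t (c • G) Z = c * Literature.Analysis.FluidPDE.duhamelTerm M.transport M.op n s t G Z := by
  induction n with
  | zero => intro s t Z; simp [Literature.Analysis.FluidPDE.duhamelTerm_zero, HierarchyModel.transport]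
  | succ n ih =>
    intro s t Z
    rw [Literature.Analysis.FluidPDE.duhamelTerm_succ, Literature.Analysis.FluidPDE.duhamelTerm_succ, ← duhamelStep_smul M c]
    congr 1
    funext τ
    congr 2
    funext Z'
    simp [ih]

/-- The Duhamel terms of the zero family vanish. [folklore] -/
theorem duhamelTerm_zero_family (n s : ℕ) (t : ℝ) (Z : Literature.Analysis.FluidPDE.Config s d X) :
    Literature.Analysis.FluidPDE.duhamelTerm M.transport M.op n s t (0 : Literature.Analysis.FluidPDE.GCState d X) Z = 0 := by
  have h := duhamelTerm_smul M 0 (0 : Literature.Analysis.FluidPDE.GCState d X) n s t Z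
  simpa using h

/-- **Additivity of the Duhamel terms** in the family, on nice families, for `t ∈ [0, T]`.
[folklore] -/
theorem duhamelTerm_add {G₁ G₂ : Literature.Analysis.FluidPDE.GCState d X} (h₁ : ∀ k, IsNice (G₁ k)) (h₂ : ∀ k, IsNice (G₂ k))
    (n : ℕ) : ∀ (s : ℕ), ∀ t ∈ Icc 0 T, ∀ Z : Literature.Analysis.FluidPDE.Config s d X,
      Literature.Analysis.FluidPDE.duhamelTerm M.transport M.op n s t (G₁ + G₂) Z =
        Literature.Analysis.FluidPDE.duhamelTerm M.transport M.op n s t G₁ Z + Literature.Analysis.FluidPDE.duhamelTerm M.transport M.op n s t G₂ Z := by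
  induction n with
  | zero => intro s t _ Z; simp [Literature.Analysis.FluidPDE.duhamelTerm_zero, HierarchyModel.transport]
  | succ n ih =>
    intro s t ht Z
    rw [Literature.Analysis.FluidPDE.duhamelTerm_succ, Literature.Analysis.FluidPDE.duhamelTerm_succ, Literature.Analysis.FluidPDE.duhamelTerm_succ,
      ← duhamelStep_add M (isNiceT_duhamelTerm M h₁ n (s + 1))
        (isNiceT_duhamelTerm M h₂ n (s + 1)) ht Z]
    refine intervalIntegral.integral_congr fun τ hτ => ?_
    rw [uIcc_of_le ht.1] at hτ
    have hτT : τ ∈ Icc 0 T := ⟨hτ.1, hτ.2.trans ht.2⟩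
    simp only [M.transport_apply]
    congr 2
    funext Z'
    exact ih (s + 1) τ hτT Z'

/-- Finite additivity of the Duhamel terms on nice families, for `t ∈ [0, T]`. [folklore] -/
theorem duhamelTerm_finset_sum {ι : Type*} (S : Finset ι) {G : ι → Literature.Analysis.FluidPDE.GCState d X}
    (h : ∀ i ∈ S, ∀ k, IsNice (G i k)) (n s : ℕ) {t : ℝ} (ht : t ∈ Icc 0 T) (Z : Literature.Analysis.FluidPDE.Config s d X) :
    Literature.Analysis.FluidPDE.duhamelTerm M.transport M.op n s t (∑ i ∈ S, G i) Z =
      ∑ i ∈ S, Literature.Analysis.FluidPDE.duhamelTerm M.transport M.op n s t (G i) Z := by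
  classical
  induction S using Finset.induction_on with
  | empty => simp [duhamelTerm_zero_family]
  | insert a S ha ih =>
    have hS : ∀ k, IsNice ((∑ i ∈ S, G i) k) := fun k => by
      simpa [Finset.sum_apply] using IsNice.sum S (g := fun i => G i k)
        fun i hi => h i (Finset.mem_insert_of_mem hi) k
    rw [Finset.sum_insert ha, Finset.sum_insert ha,
      duhamelTerm_add M (h a (Finset.mem_insert_self a S)) hS n s t ht Z,
      ih fun i hi => h i (Finset.mem_insert_of_mem hi)]

/-- Subtractivity of the Duhamel terms on nice families. [folklore] -/
theorem duhamelTerm_sub {G₁ G₂ : Literature.Analysis.FluidPDE.GCState d X} (h₁ : ∀ k, IsNice (G₁ k)) (h₂ : ∀ k, IsNice (G₂ k))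
    (n s : ℕ) {t : ℝ} (ht : t ∈ Icc 0 T) (Z : Literature.Analysis.FluidPDE.Config s d X) :
    Literature.Analysis.FluidPDE.duhamelTerm M.transport M.op n s t (G₁ - G₂) Z =
      Literature.Analysis.FluidPDE.duhamelTerm M.transport M.op n s t G₁ Z - Literature.Analysis.FluidPDE.duhamelTerm M.transport M.op n s t G₂ Z := by
  have hneg : ∀ k, IsNice ((-G₂) k) := fun k => by simpa using (h₂ k).neg
  rw [sub_eq_add_neg, duhamelTerm_add M h₁ hneg n s t ht Z]
  have : (-G₂) = (-1 : ℝ) • G₂ := by simp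
  rw [this, duhamelTerm_smul]
  ring

end Terms

/-! ## Two-time mild solutions and the finite Duhamel iteration with remainder (BGSR (4.4)) -/

section Mild

variable [MeasurableSpace X]

namespace HierarchyModel

variable (M : HierarchyModel d X)

/-- `F = (F^{(s)}(t))_s` is a *two-time mild solution* of the hierarchy `M` on `[0, T]` in the
Lanford class: every level is `IsNiceT T`, and for all `0 ≤ t'`, `0 ≤ h`, `t' + h ≤ T`,
`F^{(s)}(t' + h) = S_s(h) F^{(s)}(t') + ∫_0^h S_s(h - τ) C_s F^{(s+1)}(t' + τ) dτ`
(the mild hierarchy (3.3)/(3.7) restarted from the intermediate time `t'`, as used in BGSR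
§4.3: "iterating Duhamel's formula up to time `t - h` instead of time `0`"; the rate `α` is
part of `C_s = M.op s`). [cite: BodineauGallagherSaintRaymondInvent2016, §4.3 (4.4), p. 12] -/
structure IsMildSolution (T : ℝ) (F : (s : ℕ) → ℝ → Literature.Analysis.FluidPDE.Config s d X → ℝ) : Prop where
  niceT : ∀ s, IsNiceT T (F s)
  mild : ∀ (s : ℕ) {t' h : ℝ}, 0 ≤ t' → 0 ≤ h → t' + h ≤ T → ∀ Z : Literature.Analysis.FluidPDE.Config s d X,
    F s (t' + h) Z = M.transport s h (F s t') Z +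
      ∫ τ in (0 : ℝ)..h, M.transport s (h - τ) (M.op s (F (s + 1) (t' + τ))) Z

/-- The remainder of the `n`-fold Duhamel iteration from time `t'` over a time span `h`:
`iterRem 0 s h = F^{(s)}(t' + h)` and
`iterRem (n+1) s h = ∫_0^h S_s(h - τ) C_s (iterRem n (s+1) τ) dτ` — the `n`-fold iterated
integral `∫ S C S C ⋯ S C F^{(s+n)}(t' + ·)` with the solution itself in the innermost slot.
By `iterRem_spec` it is BGSR's `R_{s,n}(t', t' + h)` of (4.4). [cite: BodineauGallagherSaintRaymondInvent2016, §4.3 (4.4), p. 12] -/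
def iterRem (F : (s : ℕ) → ℝ → Literature.Analysis.FluidPDE.Config s d X → ℝ) (t' : ℝ) :
    ℕ → (s : ℕ) → ℝ → Literature.Analysis.FluidPDE.Config s d X → ℝ
  | 0, s, h => F s (t' + h)
  | n + 1, s, h => fun Z =>
      ∫ τ in (0 : ℝ)..h, M.transport s (h - τ) (M.op s (iterRem F t' n (s + 1) τ)) Z

/-- The order-`0` remainder is the solution itself at time `t' + h`. [folklore] -/
@[simp]
theorem iterRem_zero (F : (s : ℕ) → ℝ → Literature.Analysis.FluidPDE.Config s d X → ℝ) (t' : ℝ) (s : ℕ) (h : ℝ) :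
    M.iterRem F t' 0 s h = F s (t' + h) := rfl

/-- The recursion of the remainders (one more Duhamel step). [folklore] -/
theorem iterRem_succ (F : (s : ℕ) → ℝ → Literature.Analysis.FluidPDE.Config s d X → ℝ) (t' : ℝ) (n s : ℕ) (h : ℝ)
    (Z : Literature.Analysis.FluidPDE.Config s d X) :
    M.iterRem F t' (n + 1) s h Z =
      ∫ τ in (0 : ℝ)..h, M.transport s (h - τ) (M.op s (M.iterRem F t' n (s + 1) τ)) Z := rfl

variable {M} {T : ℝ} {F : (s : ℕ) → ℝ → Literature.Analysis.FluidPDE.Config s d X → ℝ}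

/-- The remainders are nice in the time span, on `[0, T - t']`. [folklore] -/
theorem IsMildSolution.isNiceT_iterRem (hF : M.IsMildSolution T F) {t' : ℝ} (ht' : 0 ≤ t')
    (n : ℕ) : ∀ s, IsNiceT (T - t') (fun h => M.iterRem F t' n s h) := by
  induction n with
  | zero => intro s; exact (hF.niceT s).shift ht'
  | succ n ih =>
    intro s
    exact isNiceT_duhamelStep M (ih (s + 1))

/-- The time slices of a mild solution are nice families. [folklore] -/
theorem IsMildSolution.isNice (hF : M.IsMildSolution T F) {t : ℝ} (ht : t ∈ Icc 0 T) (s : ℕ) :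
    IsNice (F s t) :=
  (hF.niceT s).isNice ht

/-- **The finite Duhamel iteration with remainder (BGSR (4.4))**: for a two-time mild solution,
`0 ≤ t'`, `h ∈ [0, T - t']`,
`F^{(s)}(t' + h) = ∑_{j<n} Q_{s,s+j}(h) F(t') + iterRem n s h`,
by induction on `n` (substitute the expansion at level `s + 1` into the last Duhamel integral;
additivity of `C_s` and of the time integral on the nice terms). [cite: BodineauGallagherSaintRaymondInvent2016, §4.3 (4.4), p. 12] -/
theorem IsMildSolution.iterRem_spec (hF : M.IsMildSolution T F) {t' : ℝ} (ht' : 0 ≤ t')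
    (ht'T : t' ≤ T) (n : ℕ) : ∀ (s : ℕ), ∀ h ∈ Icc 0 (T - t'), ∀ Z : Literature.Analysis.FluidPDE.Config s d X,
      F s (t' + h) Z =
        ∑ j ∈ Finset.range n, Literature.Analysis.FluidPDE.duhamelTerm M.transport M.op j s h (fun k => F k t') Z +
          M.iterRem F t' n s h Z := by
  have hnice : ∀ k, IsNice ((fun k => F k t') k) := fun k => hF.isNice ⟨ht', ht'T⟩ k
  induction n with
  | zero => intro s h _ Z; simp
  | succ n ih =>
    intro s h hh Z
    have hT' : 0 ≤ T - t' := hh.1.trans hh.2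
    -- the pieces at level `s + 1`, as nice time-dependent densities on `[0, T - t']`
    have hU : IsNiceT (T - t') (fun τ => F (s + 1) (t' + τ)) := (hF.niceT (s + 1)).shift ht'
    have hQ : ∀ j, IsNiceT (T - t') (fun τ => Literature.Analysis.FluidPDE.duhamelTerm M.transport M.op j (s + 1) τ fun k => F k t') :=
      fun j => isNiceT_duhamelTerm M hnice j (s + 1)
    have hS : IsNiceT (T - t')
        (fun τ => ∑ j ∈ Finset.range n, Literature.Analysis.FluidPDE.duhamelTerm M.transport M.op j (s + 1) τ fun k => F k t') :=
      IsNiceT.sum _ fun j _ => hQ j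
    -- the remainder at level `s + 1` is the difference, on `[0, T - t']`
    have hrem : ∀ τ ∈ Icc 0 (T - t'), M.iterRem F t' n (s + 1) τ =
        (fun τ => F (s + 1) (t' + τ)) τ -
          (fun τ => ∑ j ∈ Finset.range n, Literature.Analysis.FluidPDE.duhamelTerm M.transport M.op j (s + 1) τ fun k => F k t') τ := by
      intro τ hτ
      funext Z'
      have := ih (s + 1) τ hτ Z'
      simp only [Pi.sub_apply, Finset.sum_apply]
      linarith
    rw [M.iterRem_succ]
    have hcongr : ∫ τ in (0 : ℝ)..h, M.transport s (h - τ) (M.op s (M.iterRem F t' n (s + 1) τ)) Z =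
        ∫ τ in (0 : ℝ)..h, M.transport s (h - τ) (M.op s
          ((fun τ => F (s + 1) (t' + τ)) τ -
            (fun τ => ∑ j ∈ Finset.range n,
              Literature.Analysis.FluidPDE.duhamelTerm M.transport M.op j (s + 1) τ fun k => F k t') τ)) Z := by
      refine intervalIntegral.integral_congr fun τ hτ => ?_
      rw [uIcc_of_le hh.1] at hτ
      simp only
      rw [hrem τ ⟨hτ.1, hτ.2.trans hh.2⟩]
    rw [hcongr]
    -- split the integral
    have hsub : ∀ τ ∈ Icc 0 (T - t'),
        M.op s ((fun τ => F (s + 1) (t' + τ)) τ -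
          (fun τ => ∑ j ∈ Finset.range n,
            Literature.Analysis.FluidPDE.duhamelTerm M.transport M.op j (s + 1) τ fun k => F k t') τ) =
        M.op s (F (s + 1) (t' + τ)) -
          M.op s (∑ j ∈ Finset.range n,
            Literature.Analysis.FluidPDE.duhamelTerm M.transport M.op j (s + 1) τ (fun k => F k t')) :=
      fun τ hτ => M.op_sub s (hU.isNice hτ) (hS.isNice hτ)
    have h1 : ∫ τ in (0 : ℝ)..h, M.transport s (h - τ) (M.op s
          ((fun τ => F (s + 1) (t' + τ)) τ -
            (fun τ => ∑ j ∈ Finset.range n,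
              Literature.Analysis.FluidPDE.duhamelTerm M.transport M.op j (s + 1) τ fun k => F k t') τ)) Z =
        (∫ τ in (0 : ℝ)..h, M.transport s (h - τ) (M.op s (F (s + 1) (t' + τ))) Z) -
          ∫ τ in (0 : ℝ)..h, M.transport s (h - τ) (M.op s (∑ j ∈ Finset.range n,
            Literature.Analysis.FluidPDE.duhamelTerm M.transport M.op j (s + 1) τ (fun k => F k t'))) Z := by
      rw [← intervalIntegral.integral_sub (intervalIntegrable_duhamelStep M hU hh Z)
        (intervalIntegrable_duhamelStep M hS hh Z)]
      refine intervalIntegral.integral_congr fun τ hτ => ?_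
      rw [uIcc_of_le hh.1] at hτ
      simp only [M.transport_apply]
      rw [hsub τ ⟨hτ.1, hτ.2.trans hh.2⟩, Pi.sub_apply]
    rw [h1, duhamelStep_finset_sum M (Finset.range n) (fun j _ => hQ j) hh Z]
    -- recognise the mild equation and the next Duhamel terms
    have hmild := hF.mild s ht' hh.1 (by linarith [hh.2]) Z
    rw [Finset.sum_range_succ', Literature.Analysis.FluidPDE.duhamelTerm_zero]
    simp only [Literature.Analysis.FluidPDE.duhamelTerm_succ]
    linarith

/-- The remainder `iterRem n` is BGSR's `R_{s,n}(t', t'+h) = F^{(s)}(t'+h) - ∑_{j<n} Q_{s,s+j}(h)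
F(t')`. [cite: BodineauGallagherSaintRaymondInvent2016, §4.3 (4.4), p. 12] -/
theorem IsMildSolution.iterRem_eq_sub (hF : M.IsMildSolution T F) {t' : ℝ} (ht' : 0 ≤ t')
    (ht'T : t' ≤ T) (n s : ℕ) {h : ℝ} (hh : h ∈ Icc 0 (T - t')) (Z : Literature.Analysis.FluidPDE.Config s d X) :
    M.iterRem F t' n s h Z =
      F s (t' + h) Z - ∑ j ∈ Finset.range n, Literature.Analysis.FluidPDE.duhamelTerm M.transport M.op j s h (fun k => F k t') Z := by
  have := hF.iterRem_spec ht' ht'T n s h hh Z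
  linarith

/-- **Weighted bound on the remainder** (the chain estimate of BGSR Lemma 4.2 for the `n`-fold
iterated integral with the solution in the innermost slot, `Kinetic.abs_duhamelChain_le_weighted`):
if `|F^{(s+n)}(τ)| ≤ K e^{-(b₀ + nδ) H}` for `τ ∈ [t', T]` then
`|iterRem n s h (Z)| ≤ K Λⁿ hⁿ/n! e^{-b₀ H(Z)}` for `h ∈ [0, T - t']`. [cite: BodineauGallagherSaintRaymondInvent2016, §4.2 Lemma 4.2, §4.4 (4.17)] -/
theorem abs_iterRem_le_weighted (F : (s : ℕ) → ℝ → Literature.Analysis.FluidPDE.Config s d X → ℝ) {t' T : ℝ}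
    (ht'T : t' ≤ T) {bm δ : ℝ} (hbm : 0 < bm) (hδ : 0 < δ) (kmax n s : ℕ) (hk : s + n ≤ kmax + 1)
    {b₀ : ℝ} (hb₀ : bm ≤ b₀) {K : ℝ} (hK : 0 ≤ K)
    (hFb : ∀ τ ∈ Icc 0 (T - t'), ∀ Z : Literature.Analysis.FluidPDE.Config (s + n) d X,
      |F (s + n) (t' + τ) Z| ≤ K * exp (-(b₀ + n * δ) * Literature.Analysis.FluidPDE.configEnergy Z))
    {h : ℝ} (hh : h ∈ Icc 0 (T - t')) (Z : Literature.Analysis.FluidPDE.Config s d X) :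
    |M.iterRem F t' n s h Z| ≤
      K * (M.opConst * (sqrt bm ^ Fintype.card d)⁻¹ * (kmax * (sqrt bm)⁻¹ + sqrt (kmax / δ))) ^ n *
        h ^ n / n ! * exp (-b₀ * Literature.Analysis.FluidPDE.configEnergy Z) :=
  abs_duhamelChain_le_weighted M.transport_energy M.opConst_nonneg M.op_weighted (M.iterRem F t')
    (fun n s t Z => M.iterRem_succ F t' n s t Z) (sub_nonneg.2 ht'T) hbm hδ kmax n s (s + n) rfl hk
    hb₀ hK (fun τ hτ Z => by simpa using hFb τ hτ Z) h hh Z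

/-- Sanity check of the definition: the zero family is a two-time mild solution of every model
(non-trivial instances — BGSR's `g_α^{(s)} = φ_α ⊗ M_β^{⊗s}` for the Boltzmann model — are
proved in the sequel). [folklore] -/
theorem isMildSolution_zero (T : ℝ) : M.IsMildSolution T (fun _ _ _ => 0) where
  niceT := fun s => ⟨measurable_const, 0, 1, one_pos, fun t _ Z => by simp⟩
  mild := fun s t' h _ _ _ Z => by
    have h0 : (fun (_ : Literature.Analysis.FluidPDE.Config (s + 1) d X) => (0 : ℝ)) = 0 := rfl
    simp [HierarchyModel.transport, h0, M.op_zero]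

end HierarchyModel

end Mild

/-! ## Blocks: the expansion (4.5)–(4.7) -/

section Blocks

variable [MeasurableSpace X]

namespace HierarchyModel

variable (M : HierarchyModel d X)

/-- One block of the pruned expansion: the partial Duhamel sum operator
`G ↦ (∑_{j<n} Q_{s,s+j}(h) G)_s` acting on families (BGSR (4.4) without remainder; the rate
`α^j` is inside `M.op`). [cite: BodineauGallagherSaintRaymondInvent2016, §4.3 (4.4)-(4.6), pp. 12-13] -/
def blockOp (n : ℕ) (h : ℝ) (G : Literature.Analysis.FluidPDE.GCState d X) : Literature.Analysis.FluidPDE.GCState d X :=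
  fun s Z => ∑ j ∈ Finset.range n, Literature.Analysis.FluidPDE.duhamelTerm M.transport M.op j s h G Z

/-- The first `k` blocks composed, outermost (latest times) first:
`blockComp nseq h k = blockOp (nseq 0) h ∘ blockOp (nseq 1) h ∘ ⋯ ∘ blockOp (nseq (k-1)) h`
(`nseq i` is BGSR's `n_{i+1}`); expanding the composition of sums gives the multiple sum
`∑_{j_1<n_1} ⋯ ∑_{j_k<n_k} Q_{1,J_1}(h) ⋯ Q_{J_{k-1},J_k}(h)` of (4.6). [cite: BodineauGallagherSaintRaymondInvent2016, §4.3 (4.5)-(4.6), p. 13] -/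
def blockComp (nseq : ℕ → ℕ) (h : ℝ) : ℕ → Literature.Analysis.FluidPDE.GCState d X → Literature.Analysis.FluidPDE.GCState d X
  | 0 => id
  | k + 1 => fun G => blockComp nseq h k (M.blockOp (nseq k) h G)

/-- No block is the identity. [folklore] -/
@[simp]
theorem blockComp_zero (nseq : ℕ → ℕ) (h : ℝ) (G : Literature.Analysis.FluidPDE.GCState d X) : M.blockComp nseq h 0 G = G := rfl

/-- The recursion of the block composites (innermost block added last). [folklore] -/
theorem blockComp_succ (nseq : ℕ → ℕ) (h : ℝ) (k : ℕ) (G : Literature.Analysis.FluidPDE.GCState d X) :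
    M.blockComp nseq h (k + 1) G = M.blockComp nseq h k (M.blockOp (nseq k) h G) := rfl

/-- Unfolding lemma for one block. [folklore] -/
theorem blockOp_apply (n : ℕ) (h : ℝ) (G : Literature.Analysis.FluidPDE.GCState d X) (s : ℕ) (Z : Literature.Analysis.FluidPDE.Config s d X) :
    M.blockOp n h G s Z = ∑ j ∈ Finset.range n, Literature.Analysis.FluidPDE.duhamelTerm M.transport M.op j s h G Z := rfl

variable {M}

/-- Blocks preserve nice families (`h ≥ 0`). [folklore] -/
theorem isNice_blockOp {G : Literature.Analysis.FluidPDE.GCState d X} (hG : ∀ k, IsNice (G k)) (n : ℕ) {h : ℝ} (hh : 0 ≤ h)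
    (s : ℕ) : IsNice (M.blockOp n h G s) := by
  have := IsNice.sum (Finset.range n) (g := fun j => Literature.Analysis.FluidPDE.duhamelTerm M.transport M.op j s h G)
    fun j _ => isNice_duhamelTerm M hG j s hh
  convert this using 1
  funext Z
  simp [blockOp_apply, Finset.sum_apply]

/-- Blocks are additive on nice families (`h ≥ 0`). [folklore] -/
theorem blockOp_add {G₁ G₂ : Literature.Analysis.FluidPDE.GCState d X} (h₁ : ∀ k, IsNice (G₁ k)) (h₂ : ∀ k, IsNice (G₂ k))
    (n : ℕ) {h : ℝ} (hh : 0 ≤ h) :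
    M.blockOp n h (G₁ + G₂) = M.blockOp n h G₁ + M.blockOp n h G₂ := by
  funext s Z
  simp only [blockOp_apply, Pi.add_apply, ← Finset.sum_add_distrib]
  exact Finset.sum_congr rfl fun j _ => duhamelTerm_add M h₁ h₂ j s h ⟨hh, le_rfl⟩ Z

/-- Composites of blocks preserve nice families. [folklore] -/
theorem isNice_blockComp (nseq : ℕ → ℕ) {h : ℝ} (hh : 0 ≤ h) (k : ℕ) :
    ∀ {G : Literature.Analysis.FluidPDE.GCState d X}, (∀ a, IsNice (G a)) → ∀ a, IsNice (M.blockComp nseq h k G a) := by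
  induction k with
  | zero => intro G hG a; simpa using hG a
  | succ k ih => intro G hG a; exact ih (fun a => isNice_blockOp hG (nseq k) hh a) a

/-- Composites of blocks are additive on nice families. [folklore] -/
theorem blockComp_add (nseq : ℕ → ℕ) {h : ℝ} (hh : 0 ≤ h) (k : ℕ) :
    ∀ {G₁ G₂ : Literature.Analysis.FluidPDE.GCState d X}, (∀ a, IsNice (G₁ a)) → (∀ a, IsNice (G₂ a)) →
      M.blockComp nseq h k (G₁ + G₂) = M.blockComp nseq h k G₁ + M.blockComp nseq h k G₂ := by
  induction k with
  | zero => intro G₁ G₂ _ _; rfl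
  | succ k ih =>
    intro G₁ G₂ h₁ h₂
    simp only [blockComp_succ]
    rw [blockOp_add h₁ h₂ (nseq k) hh]
    exact ih (fun a => isNice_blockOp h₁ (nseq k) hh a) (fun a => isNice_blockOp h₂ (nseq k) hh a)

variable {T : ℝ} {F : (s : ℕ) → ℝ → Literature.Analysis.FluidPDE.Config s d X → ℝ}

/-- **The block expansion (BGSR (4.5)–(4.7), nested form).** For a two-time mild solution `F`
on `[0, T]`, a step `h ≥ 0`, thresholds `nseq`, a time `t ≤ T` and a number of blocks `k` with
`t - kh ≥ 0`:
`F^{(s)}(t) = (blockComp k [F(t - kh)])^{(s)} + ∑_{i<k} (blockComp i [Rem_i])^{(s)}`, where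
`Rem_i^{(a)} = iterRem M F (t - (i+1)h) (nseq i) a h` is the remainder of block `i + 1`
(BGSR's `R_{J_i, n_{i+1}}(t - (i+1)h, t - ih)`). For `t = Kh`, `k = K`, `s = 1` the first term is
`f^{(1,K)}(t)` and the sum is `R^K(t)` of (4.5)–(4.6) (`g^{(1,K)}`, `R^{0,K}` of (4.7) for the
Boltzmann model), in nested form. Proof: induction on `k`, substituting `iterRem_spec` for block
`k + 1` and using the additivity of `blockComp k` on nice families.
[cite: BodineauGallagherSaintRaymondInvent2016, §4.3 (4.5)-(4.7), p. 13] -/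
theorem IsMildSolution.blockComp_spec (hF : M.IsMildSolution T F) (nseq : ℕ → ℕ) {h : ℝ}
    (hh : 0 ≤ h) {t : ℝ} (htT : t ≤ T) (k : ℕ) (hk : 0 ≤ t - k * h) (s : ℕ) (Z : Literature.Analysis.FluidPDE.Config s d X) :
    F s t Z =
      M.blockComp nseq h k (fun a => F a (t - k * h)) s Z +
        ∑ i ∈ Finset.range k,
          M.blockComp nseq h i (fun a Z => M.iterRem F (t - (i + 1) * h) (nseq i) a h Z) s Z := by
  induction k generalizing s Z with
  | zero => simp
  | succ k ih =>
    have hk' : 0 ≤ t - k * h := by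
      have : (k : ℝ) * h ≤ (k + 1 : ℕ) * h := by push_cast; nlinarith
      push_cast at hk ⊢; nlinarith
    rw [ih hk' s Z, Finset.sum_range_succ, blockComp_succ]
    -- expand `F(t - kh)` from `F(t - (k+1)h)` over one block of length `h`
    set t₁ := t - (k + 1 : ℕ) * h with ht₁
    have ht₁0 : 0 ≤ t₁ := hk
    have ht₁T : t₁ ≤ T := by
      rw [ht₁]; push_cast
      nlinarith [mul_nonneg (by positivity : (0 : ℝ) ≤ k + 1) hh]
    have hhI : h ∈ Icc 0 (T - t₁) := ⟨hh, by rw [ht₁]; push_cast; nlinarith [mul_nonneg (Nat.cast_nonneg k) hh]⟩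
    have hkey : (fun a => F a (t - k * h)) =
        M.blockOp (nseq k) h (fun a => F a t₁) + fun a Z => M.iterRem F t₁ (nseq k) a h Z := by
      funext a Z'
      have heq : t - k * h = t₁ + h := by rw [ht₁]; push_cast; ring
      rw [heq, hF.iterRem_spec ht₁0 ht₁T (nseq k) a h hhI Z']
      simp [blockOp_apply]
    have hn1 : ∀ a, IsNice (M.blockOp (nseq k) h (fun a => F a t₁) a) :=
      fun a => isNice_blockOp (fun a => hF.isNice ⟨ht₁0, ht₁T⟩ a) (nseq k) hh a
    have hn2 : ∀ a, IsNice ((fun a Z => M.iterRem F t₁ (nseq k) a h Z) a) :=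
      fun a => (hF.isNiceT_iterRem ht₁0 (nseq k) a).isNice hhI
    rw [hkey, blockComp_add nseq hh k hn1 hn2]
    have hcast : (t - ((k : ℕ) + 1) * h : ℝ) = t₁ := by rw [ht₁]; push_cast; ring
    simp only [Pi.add_apply, hcast]
    ring

end HierarchyModel

end Blocks

/-! ## The two instances -/

section Instances

variable [MeasurableSpace X]

omit [MeasurableSpace X] in
/-- Homogeneity of the hard-sphere collision term (two `integral_const_mul`). [folklore] -/
theorem hsCollisionTerm_smul (G : Literature.Analysis.FluidPDE.Geometry d X) (ε : ℝ) (s : ℕ) (i : Fin s) (c : ℝ)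
    (g : Literature.Analysis.FluidPDE.Config (s + 1) d X → ℝ) (Zs : Literature.Analysis.FluidPDE.Config s d X) :
    Literature.Analysis.FluidPDE.hsCollisionTerm G ε s i (c • g) Zs = c * Literature.Analysis.FluidPDE.hsCollisionTerm G ε s i g Zs := by
  unfold Literature.Analysis.FluidPDE.hsCollisionTerm
  rw [← integral_const_mul]
  refine integral_congr_ae (Eventually.of_forall fun ω => ?_)
  simp only
  rw [← integral_const_mul]
  refine integral_congr_ae (Eventually.of_forall fun v => ?_)
  simp only [Pi.smul_apply, smul_eq_mul]
  ring

/-- Free flight is jointly measurable in time and datum for a geometry with measurable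
translation map. [folklore] -/
theorem measurable_freeFlight_uncurry {G : Literature.Analysis.FluidPDE.Geometry d X}
    (hG : Measurable fun p : X × EuclideanSpace ℝ d => G.translate p.1 p.2) (s : ℕ) :
    Measurable fun p : ℝ × Literature.Analysis.FluidPDE.Config s d X => Literature.Analysis.FluidPDE.freeFlight G p.1 p.2 := by
  refine measurable_pi_lambda _ fun i => ?_
  have hi : Measurable fun p : ℝ × Literature.Analysis.FluidPDE.Config s d X => p.2 i := (measurable_pi_apply i).comp measurable_snd
  have hx : Measurable fun p : ℝ × Literature.Analysis.FluidPDE.Config s d X => (p.2 i).1 := hi.fst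
  have hv : Measurable fun p : ℝ × Literature.Analysis.FluidPDE.Config s d X => (p.2 i).2 := hi.snd
  have hsmul : Measurable fun p : ℝ × Literature.Analysis.FluidPDE.Config s d X => p.1 • (p.2 i).2 :=
    continuous_smul.measurable.comp (measurable_fst.prodMk hv)
  simp only [Literature.Analysis.FluidPDE.freeFlight_apply]
  exact (hG.comp (hx.prodMk hsmul)).prodMk hv

/-- **The Boltzmann hierarchy with rate `α` as a `HierarchyModel`**: free flight and
`C_s = α C⁰_{s,s+1}` (`Kinetic.boltzmannHOp`), for a geometry with measurable translation map;
`opConst = |α| C_d` with the constant `C_d = J_d |S^{d-1}|` of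
`Kinetic.abs_boltzmannHOp_le_weighted`. This is the hierarchy (3.7)–(3.8) of BGSR.
[cite: BodineauGallagherSaintRaymondInvent2016, §3.3 (3.7)-(3.8), p. 10] -/
def boltzmannModel (G : Literature.Analysis.FluidPDE.Geometry d X)
    (hG : Measurable fun p : X × EuclideanSpace ℝ d => G.translate p.1 p.2) (α : ℝ) :
    HierarchyModel d X where
  flow := fun s t => Literature.Analysis.FluidPDE.freeFlight G t
  op := fun s g Z => α * Literature.Analysis.FluidPDE.boltzmannHOp G s g Z
  opConst := |α| * ((∫ u : EuclideanSpace ℝ d, (1 + ‖u‖) * exp (-(1 / 2) * ‖u‖ ^ 2)) *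
    (KineticTheory.sphereMeasure : Measure (sphere (0 : EuclideanSpace ℝ d) 1)).real univ)
  configEnergy_flow := fun s t Z => Literature.Analysis.FluidPDE.configEnergy_freeFlight G t Z
  measurable_flow := measurable_freeFlight_uncurry hG
  measurable_op := fun s u hu => by
    have h : Measurable fun p : ℝ × Literature.Analysis.FluidPDE.Config s d X => Literature.Analysis.FluidPDE.boltzmannHOp G s (fun Z => u (p.1, Z)) p.2 := by
      simp only [Literature.Analysis.FluidPDE.boltzmannHOp, Literature.Analysis.FluidPDE.boltzmannHierarchyOp]
      exact Finset.measurable_sum _ fun i _ => Literature.Analysis.FluidPDE.measurable_hsCollisionTerm_param hG 0 i hu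
    exact h.const_mul α
  op_add := fun s g₁ g₂ h₁ h₂ => by
    funext Z
    simp only [Pi.add_apply, Literature.Analysis.FluidPDE.boltzmannHOp, Literature.Analysis.FluidPDE.boltzmannHierarchyOp]
    have key : ∀ i : Fin s, Literature.Analysis.FluidPDE.hsCollisionTerm G 0 s i (g₁ + g₂) Z =
        Literature.Analysis.FluidPDE.hsCollisionTerm G 0 s i g₁ Z + Literature.Analysis.FluidPDE.hsCollisionTerm G 0 s i g₂ Z := by
      intro i
      have h := Literature.Analysis.FluidPDE.hsCollisionTerm_finset_sum hG 0 i (Finset.univ : Finset Bool)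
        (g := fun b => bif b then g₁ else g₂) (fun b _ => by cases b <;> simp only [cond_true, cond_false] <;> first
          | exact h₁.1 | exact h₂.1)
        (fun b _ => by cases b <;> simp only [cond_true, cond_false] <;> first
          | exact h₁.2 | exact h₂.2) Z
      simpa [Fintype.sum_bool] using h
    rw [Finset.sum_congr rfl fun i _ => key i, Finset.sum_add_distrib, mul_add]
  op_smul := fun s c g => by
    funext Z
    simp only [Pi.smul_apply, smul_eq_mul, Literature.Analysis.FluidPDE.boltzmannHOp, Literature.Analysis.FluidPDE.boltzmannHierarchyOp]
    rw [Finset.mul_sum, Finset.mul_sum, Finset.mul_sum]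
    refine Finset.sum_congr rfl fun i _ => ?_
    rw [hsCollisionTerm_smul]
    ring
  opConst_nonneg := by
    haveI := Literature.Analysis.FluidPDE.isFiniteMeasure_sphereMeasure (E := EuclideanSpace ℝ d)
    have hJ : 0 ≤ ∫ u : EuclideanSpace ℝ d, (1 + ‖u‖) * exp (-(1 / 2) * ‖u‖ ^ 2) :=
      integral_nonneg fun u => by positivity
    exact mul_nonneg (abs_nonneg α) (mul_nonneg hJ measureReal_nonneg)
  op_weighted := fun k g K b hb hK hg Z => by
    rw [abs_mul]
    have h := abs_boltzmannHOp_le_weighted G k hb hg Z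
    calc |α| * |Literature.Analysis.FluidPDE.boltzmannHOp G k g Z| ≤ |α| * _ := mul_le_mul_of_nonneg_left h (abs_nonneg α)
      _ = _ := by ring

/-- The flow of the Boltzmann model is free flight. [folklore] -/
@[simp]
theorem boltzmannModel_flow (G : Literature.Analysis.FluidPDE.Geometry d X)
    (hG : Measurable fun p : X × EuclideanSpace ℝ d => G.translate p.1 p.2) (α : ℝ) (s : ℕ) (t : ℝ) :
    (boltzmannModel G hG α).flow s t = Literature.Analysis.FluidPDE.freeFlight G t := rfl

/-- The transport of the Boltzmann model is free transport. [folklore] -/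
theorem boltzmannModel_transport (G : Literature.Analysis.FluidPDE.Geometry d X)
    (hG : Measurable fun p : X × EuclideanSpace ℝ d => G.translate p.1 p.2) (α : ℝ) :
    (boltzmannModel G hG α).transport = Literature.Analysis.FluidPDE.freeTransport G := by
  funext s t g Z
  rfl

/-- The collision operator of the Boltzmann model is `α C⁰_{s,s+1}`. [folklore] -/
@[simp]
theorem boltzmannModel_op (G : Literature.Analysis.FluidPDE.Geometry d X)
    (hG : Measurable fun p : X × EuclideanSpace ℝ d => G.translate p.1 p.2) (α : ℝ) (s : ℕ)
    (g : Literature.Analysis.FluidPDE.Config (s + 1) d X → ℝ) (Z : Literature.Analysis.FluidPDE.Config s d X) :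
    (boltzmannModel G hG α).op s g Z = α * Literature.Analysis.FluidPDE.boltzmannHOp G s g Z := rfl

/-- **The Duhamel terms of the Boltzmann model are `αⁿ Q⁰_{s,s+n}(t)`**
(`Kinetic.boltzmannDuhamelTerm`), for every family (no hypothesis: homogeneity only).
[cite: BodineauGallagherSaintRaymondInvent2016, §3.3 (3.8), p. 10] -/
theorem duhamelTerm_boltzmannModel (G : Literature.Analysis.FluidPDE.Geometry d X)
    (hG : Measurable fun p : X × EuclideanSpace ℝ d => G.translate p.1 p.2) (α : ℝ) (n : ℕ) :
    ∀ (s : ℕ) (t : ℝ) (F₀ : Literature.Analysis.FluidPDE.GCState d X) (Z : Literature.Analysis.FluidPDE.Config s d X),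
      Literature.Analysis.FluidPDE.duhamelTerm (boltzmannModel G hG α).transport (boltzmannModel G hG α).op n s t F₀ Z =
        α ^ n * Literature.Analysis.FluidPDE.boltzmannDuhamelTerm G n s t F₀ Z := by
  induction n with
  | zero => intro s t F₀ Z; simp [Literature.Analysis.FluidPDE.boltzmannDuhamelTerm, Literature.Analysis.FluidPDE.duhamelTerm_zero, boltzmannModel_transport]
  | succ n ih =>
    intro s t F₀ Z
    rw [Literature.Analysis.FluidPDE.duhamelTerm_succ, Literature.Analysis.FluidPDE.boltzmannDuhamelTerm, Literature.Analysis.FluidPDE.duhamelTerm_succ, ← Literature.Analysis.FluidPDE.boltzmannDuhamelTerm,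
      ← intervalIntegral.integral_const_mul]
    refine intervalIntegral.integral_congr fun τ _ => ?_
    simp only [boltzmannModel_transport, Literature.Analysis.FluidPDE.freeTransport_apply, boltzmannModel_op]
    have hfun : Literature.Analysis.FluidPDE.duhamelTerm (Literature.Analysis.FluidPDE.freeTransport G) (boltzmannModel G hG α).op n (s + 1) τ F₀ =
        fun Z' => α ^ n * Literature.Analysis.FluidPDE.boltzmannDuhamelTerm G n (s + 1) τ F₀ Z' := by
      funext Z'
      rw [← boltzmannModel_transport G hG α]
      exact ih (s + 1) τ F₀ Z'
    rw [hfun]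
    have hsm : (fun Z' => α ^ n * Literature.Analysis.FluidPDE.boltzmannDuhamelTerm G n (s + 1) τ F₀ Z') =
        (α ^ n) • Literature.Analysis.FluidPDE.boltzmannDuhamelTerm G n (s + 1) τ F₀ := by
      funext Z'; simp
    rw [hsm]
    have hop := (boltzmannModel G hG α).op_smul s (α ^ n) (Literature.Analysis.FluidPDE.boltzmannDuhamelTerm G n (s + 1) τ F₀)
    have hop' := congrFun hop (Literature.Analysis.FluidPDE.freeFlight G (-(t - τ)) Z)
    simp only [boltzmannModel_op, Pi.smul_apply, smul_eq_mul] at hop'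
    rw [hop']
    ring

end Instances

section BBGKYInstance

variable [MeasureSpace X] [TopologicalSpace X]

/-- **The BBGKY hierarchy as a `HierarchyModel`**: hard-sphere transports along flows `Φ^s`
conserving the kinetic energy everywhere and jointly measurable in `(t, Z)`, and the BBGKY
collision operator `C_{s,s+1}` of the tree (prefactor `(N-s)ε^{d-1}`, GST (4.3.5)), `ε ≥ 0`,
for a geometry with measurable translation map (the hypotheses of
`Kinetic.IsMildBBGKYSolutionOn.eq_sum_bbgkyDuhamelTerm`); `opConst = N ε^{d-1} C_d`
(`Kinetic.abs_bbgkyOp_le_weighted`). This is the hierarchy (3.3)–(3.6) of BGSR with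
`α = Nε^{d-1}` absorbed. [cite: BodineauGallagherSaintRaymondInvent2016, §3.2 (3.3)-(3.6), p. 9] -/
def bbgkyModel (G : Literature.Analysis.FluidPDE.Geometry d X)
    (hG : Measurable fun p : X × EuclideanSpace ℝ d => G.translate p.1 p.2) {ε : ℝ} (hε : 0 ≤ ε)
    (N : ℕ) (Φ : (s : ℕ) → Literature.Analysis.FluidPDE.HardSphereFlow G ε s)
    (hΦE : ∀ (s : ℕ) (t : ℝ) (z : Literature.Analysis.FluidPDE.Config s d X), Literature.Analysis.FluidPDE.configEnergy ((Φ s).flow t z) = Literature.Analysis.FluidPDE.configEnergy z)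
    (hΦm : ∀ s : ℕ, Measurable fun p : ℝ × Literature.Analysis.FluidPDE.Config s d X => (Φ s).flow p.1 p.2) :
    HierarchyModel d X where
  flow := fun s t => (Φ s).flow t
  op := Literature.Analysis.FluidPDE.bbgkyOp G ε N
  opConst := (N * ε ^ (Fintype.card d - 1)) *
    ((∫ u : EuclideanSpace ℝ d, (1 + ‖u‖) * exp (-(1 / 2) * ‖u‖ ^ 2)) *
      (KineticTheory.sphereMeasure : Measure (sphere (0 : EuclideanSpace ℝ d) 1)).real univ)
  configEnergy_flow := hΦE
  measurable_flow := hΦm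
  measurable_op := fun s u hu => Literature.Analysis.FluidPDE.measurable_bbgkyOp_param hG ε N s hu
  op_add := fun s g₁ g₂ h₁ h₂ => by
    have h := Literature.Analysis.FluidPDE.bbgkyOp_finset_sum hG ε N s (Finset.univ : Finset Bool)
      (g := fun b => bif b then g₁ else g₂) (fun b _ => by cases b <;> simp only [cond_true, cond_false] <;> first
          | exact h₁.1 | exact h₂.1)
      (fun b _ => by cases b <;> simp only [cond_true, cond_false] <;> first | exact h₁.2 | exact h₂.2)
    simpa [Fintype.sum_bool] using h
  op_smul := fun s c g => by
    funext Z
    simp only [Pi.smul_apply, smul_eq_mul, Literature.Analysis.FluidPDE.bbgkyOp, Literature.Analysis.FluidPDE.bbgkyCollisionOp, Finset.mul_sum]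
    refine Finset.sum_congr rfl fun i _ => ?_
    rw [hsCollisionTerm_smul]
    ring
  opConst_nonneg := by
    haveI := Literature.Analysis.FluidPDE.isFiniteMeasure_sphereMeasure (E := EuclideanSpace ℝ d)
    have hJ : 0 ≤ ∫ u : EuclideanSpace ℝ d, (1 + ‖u‖) * exp (-(1 / 2) * ‖u‖ ^ 2) :=
      integral_nonneg fun u => by positivity
    exact mul_nonneg (by positivity) (mul_nonneg hJ measureReal_nonneg)
  op_weighted := fun k g K b hb hK hg Z => abs_bbgkyOp_le_weighted G hε N k hb hg Z

/-- **The Duhamel terms of the BBGKY model are the tree's `Q_{s,s+n}(t)`**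
(`Kinetic.bbgkyDuhamelTerm`), definitionally. [folklore] -/
theorem duhamelTerm_bbgkyModel (G : Literature.Analysis.FluidPDE.Geometry d X)
    (hG : Measurable fun p : X × EuclideanSpace ℝ d => G.translate p.1 p.2) {ε : ℝ} (hε : 0 ≤ ε)
    (N : ℕ) (Φ : (s : ℕ) → Literature.Analysis.FluidPDE.HardSphereFlow G ε s)
    (hΦE : ∀ (s : ℕ) (t : ℝ) (z : Literature.Analysis.FluidPDE.Config s d X), Literature.Analysis.FluidPDE.configEnergy ((Φ s).flow t z) = Literature.Analysis.FluidPDE.configEnergy z)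
    (hΦm : ∀ s : ℕ, Measurable fun p : ℝ × Literature.Analysis.FluidPDE.Config s d X => (Φ s).flow p.1 p.2) (n s : ℕ) (t : ℝ)
    (F₀ : Literature.Analysis.FluidPDE.GCState d X) (Z : Literature.Analysis.FluidPDE.Config s d X) :
    Literature.Analysis.FluidPDE.duhamelTerm (bbgkyModel G hG hε N Φ hΦE hΦm).transport (bbgkyModel G hG hε N Φ hΦE hΦm).op
      n s t F₀ Z = Literature.Analysis.FluidPDE.bbgkyDuhamelTerm G ε N Φ n s t F₀ Z := by
  rfl

end BBGKYInstance

end Kinetic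

end

end Literature.MathematicalPhysics.KineticTheory
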